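import Literature.Computability.Complexity.IoAvgHardLanguage
import Literature.Computability.Complexity.IKWGenMachine
import Literature.Computability.Complexity.PadEvaluation
import Literature.Computability.Complexity.ExpPadding
import Literature.Computability.Complexity.SplitOnesBricks
import Literature.Computability.Complexity.StackBricksStrings
import Literature.Computability.Complexity.IKWScales
import Literature.Computability.Complexity.UniversalNEXPLanguage
import HarnessLib

/-!
# The interleaved hard language is in `EXP` (machine half of `IoAvgHardLanguage.lean`)

For `L ∈ DTIME(2^{n^b})` this file realises the slices of `IoHard.hardLang L` (at length
`n' = ⟨j, 40(m+2)⟩`: the amplified function `IKWGen.g2 (L↾{0,1}^m) ((m+2)^j)` on the first `L₂` bits)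
by a deterministic machine in time `2^{n^{c₁+1}}`, `c₁ = b + 3`, and concludes the input of the case
`EXP ⊄ P/poly` of Impagliazzo–Wigderson 1998 in the exact form consumed by
`Learning/IWPadGeneratorFools.uniformPRG_of_ioAvgHard`:

* the machine works on the exponential pad `expPad c₁ x = 1^{2^{|x|^{c₁}}} 0 x` (`ExpPadding.lean`, time
  `C · 2^{n^{c₁}} + C`) followed by ONE polynomial-time string function, written in the typed `CodeFP`
  algebra (`CodeFP*.lean`): decode `(j, m)` from `|x|` (`Nat.unpair`: `natSqrt`, `natSub`, `natLt`), the
  target `n = (m+2)^j` in binary (`natPow`) and in unary capped by the pad (`unOfNatMin`), the truth table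
  of `L↾{0,1}^m` by `2^m` budgeted runs of `L`'s decider with the pad as budget
  (`PadEvaluation.exists_FP_decide_of_budget`, `rangeOf`, `map`), and finally the amplified bit by the
  brick `IKWGenM.codeFP_ampT` of the tree's IKW machine (`ampT_ofFn`: it IS `IKWGen.g2`);
* `IoHard.Φ` — the total function the program computes (junk-free thanks to the `min`-caps), `codeFP_Φ`,
  `exists_FP_Φ`; `IoHard.machLang F c₁` — the language decided, **`machLang_mem_DTIME`**;
* `ampT_congr` (the amplified bit reads only the first `L₂` bits of its argument), **`Φ_eq_hardBitAt`**
  (on a pad covering the table, the target and the budget, `Φ` is the hard bit), and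
  **`eventually_sliceFn_machLang_eq`**: for all large `n'` the slices of `machLang` and `hardLang L` agree;
* **`exists_ioAvgHard_of_not_EXP_subset_PPoly`** — under `EXP ⊄ P/poly` there is `H ∈ DTIME(2^{n^{b'}})`
  with `∀ c, ∃^∞ n, H_avg(H↾{0,1}ⁿ) ≥ n^c` (Babai–Fortnow–Nisan–Wigderson's theorem in the form used by
  the uniform-derandomization hinge).

Everything is proved; the definitions are the program's total functions and the language (no named
facts).

## References

* L. Babai, L. Fortnow, N. Nisan, A. Wigderson, Comput. Complexity 3 (1993) 307–318, §4 (not held; cited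
  through IW 2001 §2.1 / van Melkebeek Thm. 2.3.7).
* [ImpagliazzoWigderson2001] R. Impagliazzo, A. Wigderson, JCSS 63 (2001), §2.1.
* [ImpagliazzoKabanetsWigderson2002] R. Impagliazzo, V. Kabanets, A. Wigderson, JCSS 65 (2002), Thm. 11
  (the machine of the amplified function, `IKWGenMachine.lean`).
* [AroraBarakCC2009] S. Arora, B. Barak, CUP 2009, §2.6.2 (padding), Thm. 1.9 / §1.4.1 (clocked universal
  simulation), §1.3 (composition).
* [VanMelkebeek2000] D. van Melkebeek, LNCS 1950 (2000), Thm. 2.3.7 (p. 37).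
-/

noncomputable section

namespace Literature.Computability.Complexity

open _root_.Computability Finset Filter Polynomial Brick Plumb MetaComplexity IKWGen IKWGenM CodeFP

namespace IoHard

/-! ### The program, as total functions of the argument `a = (P, x)` (pad length, input) -/

/-- Arguments `(P, x)`: the pad length and the input string. [folklore] -/
abbrev Arg : Type := ℕ × List Bool

/-- Their code `⟨1^P, x⟩`. [folklore] -/
abbrev argE : Arg → List Bool := pairE unE strE

/-- The input length `n' = |x|`. [folklore] -/
def lenA (a : Arg) : ℕ := a.2.length

/-- `⌊√n'⌋`. [folklore] -/
def sqA (a : Arg) : ℕ := Nat.sqrt (lenA a)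

/-- `n' − ⌊√n'⌋²`. [folklore] -/
def dA (a : Arg) : ℕ := lenA a - sqA a * sqA a

/-- The tuning exponent `j = (unpair n').1`. [folklore] -/
def jA (a : Arg) : ℕ := (Nat.unpair (lenA a)).1

/-- The second component `(unpair n').2`. [folklore] -/
def MA (a : Arg) : ℕ := (Nat.unpair (lenA a)).2

/-- The source length `m = (unpair n').2 / 40 − 2`. [folklore] -/
def mA (a : Arg) : ℕ := MA a / 40 - 2

/-- `m` capped by `n'` (equal to `m`; the cap makes the unary conversion polynomial). [folklore] -/
def mU (a : Arg) : ℕ := min (mA a) (lenA a)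

/-- `j` capped by `n'` (equal to `j`). [folklore] -/
def jU (a : Arg) : ℕ := min (jA a) (lenA a)

/-- The target `n = (m+2)^j` (binary). [folklore] -/
def nA (a : Arg) : ℕ := (mA a + 2) ^ jU a

/-- The target capped by the pad (unary). [folklore] -/
def nU (a : Arg) : ℕ := min (nA a) a.1

/-- The table indices `0, …, min(2^m, P) − 1`. [folklore] -/
def tblIdx (a : Arg) : List ℕ := List.range (min (2 ^ mU a) a.1)

variable (F : List Bool → List Bool)

/-- The table entry `i`: the budgeted decider on the `m`-bit numeral of `i`, pad as budget. [folklore] -/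
def entry (a : Arg) (i : ℕ) : Bool := (F (boolPair (ones a.1) (List.takeD (mU a) (natE i) false))).headD false

/-- The computed table. [folklore] -/
def tbl (a : Arg) : List Bool := (tblIdx a).map (entry F a)

/-- The argument handed to the IKW brick: `(table, (1^n, []))`. [folklore] -/
def cOf (a : Arg) : In := (tbl F a, (nU a, []))

/-- **The computed bit**: the amplified bit of the IKW machine on the computed table, the target and the
input string. [cite: ImpagliazzoKabanetsWigderson2002, Thm. 11] -/
def Φ (a : Arg) : Bool := ampT (BT (cOf F a)) (mOfT (tbl F a)) (nU a) (tbl F a) a.2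

/-! ### The program on codes -/

/-- `codeFP_lenU`: a step of the program on codes. [folklore] -/
theorem codeFP_lenU : CodeFP argE unE lenA := (strLength.comp (snd unE strE)).congr fun _ => rfl

/-- `codeFP_lenN`: a step of the program on codes. [folklore] -/
theorem codeFP_lenN : CodeFP argE natE lenA := (strNatLength.comp (snd unE strE)).congr fun _ => rfl

/-- `codeFP_sq`: a step of the program on codes. [folklore] -/
theorem codeFP_sq : CodeFP argE natE sqA := (natSqrt.comp codeFP_lenN).congr fun _ => rfl

/-- `codeFP_d`: a step of the program on codes. [folklore] -/
theorem codeFP_d : CodeFP argE natE dA :=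
  (natSub.comp (codeFP_lenN.pair (natMul.comp (codeFP_sq.pair codeFP_sq)))).congr fun _ => rfl

/-- `codeFP_cond`: a step of the program on codes. [folklore] -/
theorem codeFP_cond : CodeFP argE bitE (fun a => decide (dA a < sqA a)) :=
  (natLt.comp (codeFP_d.pair codeFP_sq)).congr fun _ => rfl

/-- `codeFP_j`: a step of the program on codes. [folklore] -/
theorem codeFP_j : CodeFP argE natE jA := by
  refine (ite codeFP_cond codeFP_d codeFP_sq).congr fun a => ?_
  unfold jA Nat.unpair dA sqA
  simp only [decide_eq_true_eq]
  split_ifs <;> rfl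

/-- `codeFP_M`: a step of the program on codes. [folklore] -/
theorem codeFP_M : CodeFP argE natE MA := by
  refine (ite codeFP_cond codeFP_sq (natSub.comp (codeFP_d.pair codeFP_sq))).congr fun a => ?_
  unfold MA Nat.unpair dA sqA
  simp only [decide_eq_true_eq]
  split_ifs <;> rfl

/-- `codeFP_m`: a step of the program on codes. [folklore] -/
theorem codeFP_m : CodeFP argE natE mA :=
  (natSub.comp ((natDiv.comp (codeFP_M.pair (const argE (40 : ℕ)))).pair (const argE (2 : ℕ)))).congr
    fun _ => rfl

/-- `codeFP_mU`: a step of the program on codes. [folklore] -/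
theorem codeFP_mU : CodeFP argE unE mU := (unOfNatMin.comp (codeFP_lenU.pair codeFP_m)).congr fun _ => rfl

/-- `codeFP_jU`: a step of the program on codes. [folklore] -/
theorem codeFP_jU : CodeFP argE unE jU := (unOfNatMin.comp (codeFP_lenU.pair codeFP_j)).congr fun _ => rfl

/-- `codeFP_nA`: a step of the program on codes. [folklore] -/
theorem codeFP_nA : CodeFP argE natE nA :=
  (natPow.comp ((natAdd.comp (codeFP_m.pair (const argE (2 : ℕ)))).pair codeFP_jU)).congr fun _ => rfl

/-- `codeFP_nU`: a step of the program on codes. [folklore] -/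
theorem codeFP_nU : CodeFP argE unE nU := (unOfNatMin.comp ((fst unE strE).pair codeFP_nA)).congr fun _ => rfl

/-- `codeFP_tblIdx`: a step of the program on codes. [folklore] -/
theorem codeFP_tblIdx : CodeFP argE (rawE natE) tblIdx :=
  (rangeOf.comp ((fst unE strE).pair (natPow.comp ((const argE (2 : ℕ)).pair codeFP_mU)))).congr fun _ => rfl

/-- The `m`-bit numeral of the index. [folklore] -/
theorem codeFP_numeral : CodeFP (pairE unE natE) strE (fun q => List.takeD q.1 (natE q.2) false) :=
  of_fn (fstF ∘ padTakeFn) (comp_mem_FP fstF_mem_FP padTakeFn_mem_FP) fun q => by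
    obtain ⟨k, i⟩ := q
    simp [pairE, unE_eq_ones, ones, strE]

variable {F}

/-- The budgeted decider as a map on codes `⟨1^P, u⟩ ↦ F ⟨1^P, u⟩`. [folklore] -/
theorem codeFP_F (hF : F ∈ FP) : CodeFP (pairE unE strE) strE (fun q => F (boolPair (ones q.1) q.2)) :=
  of_fn F hF fun q => by obtain ⟨P, u⟩ := q; simp [pairE, unE_eq_ones, strE]

/-- The first bit of a string. [folklore] -/
theorem codeFP_headD : CodeFP strE bitE (fun l : List Bool => l.headD false) :=
  of_fn HashBricks.headBitFn HashBricks.headBitFn_mem_FP fun l => by simp [strE, bitE]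

/-- `codeFP_entry`: a step of the program on codes. [folklore] -/
theorem codeFP_entry (hF : F ∈ FP) : CodeFP (pairE argE natE) bitE (fun t => entry F t.1 t.2) :=
  (codeFP_headD.comp ((codeFP_F hF).comp (((fst argE natE).fst').pair
    (codeFP_numeral.comp ((codeFP_mU.comp (fst argE natE)).pair (snd argE natE)))))).congr fun _ => rfl

/-- `codeFP_tblRaw`: a step of the program on codes. [folklore] -/
theorem codeFP_tblRaw (hF : F ∈ FP) : CodeFP argE (rawE bitE) (tbl F) :=
  ((map (codeFP_entry hF)).comp ((CodeFP.id argE).pair codeFP_tblIdx)).congr fun _ => rfl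

/-- `codeFP_tbl`: a step of the program on codes. [folklore] -/
theorem codeFP_tbl (hF : F ∈ FP) : CodeFP argE strE (tbl F) := (bitsToStr.comp (codeFP_tblRaw hF)).congr fun _ => rfl

/-- `codeFP_cOf`: a step of the program on codes. [folklore] -/
theorem codeFP_cOf (hF : F ∈ FP) : CodeFP argE inE (cOf F) :=
  ((codeFP_tbl hF).pair (codeFP_nU.pair (const argE ([] : List Bool)))).congr fun _ => rfl

/-- A string as a raw list of bits (chunks of length one). [folklore] -/
theorem codeFP_strToRaw : CodeFP strE (rawE bitE) (fun l : List Bool => l) := by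
  have h := strChunks.comp (strLength.pair ((const strE (1 : ℕ)).pair (CodeFP.id strE)))
  refine h.recodeOut fun l => ?_
  show rawE strE ((List.range l.length).map fun i => (l.drop (i * 1)).take 1) = rawE bitE l
  unfold rawE
  congr 1
  rw [List.map_map]
  apply List.ext_getElem
  · simp
  · intro i h₁ h₂
    rw [List.length_map, List.length_range] at h₁
    simp [bitE, strE, List.take_one_drop_eq_of_lt_length h₁]

/-- **The whole program on codes**: `(P, x) ↦ Φ F (P, x)` is computed in polynomial time on `⟨1^P, x⟩`.
[cite: AroraBarakCC2009, §1.3] [cite: ImpagliazzoKabanetsWigderson2002, Thm. 11] -/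
theorem codeFP_Φ (hF : F ∈ FP) : CodeFP argE bitE (Φ F) :=
  (codeFP_ampT.comp ((codeFP_cOf hF).pair (codeFP_strToRaw.comp (snd unE strE)))).congr fun _ => rfl

/-- **The program as one `FP` string function on the padded input** `1^P 0 x`.
[cite: AroraBarakCC2009, §1.3 and §2.6.2] -/
theorem exists_FP_Φ (hF : F ∈ FP) : ∃ Q ∈ FP, ∀ (P : ℕ) (x : List Bool), Q (ones P ++ false :: x) = [Φ F (P, x)] := by
  obtain ⟨f, hf, hfΦ⟩ := codeFP_Φ hF
  refine ⟨f ∘ fanoutFn onesPrefixFn afterZeroFn, comp_mem_FP hf (fanoutFn_mem_FP onesPrefixFn_mem_FP afterZeroFn_mem_FP),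
    fun P x => ?_⟩
  have := hfΦ (P, x)
  simp only [argE, pairE, unE_eq_ones, strE, id] at this
  simpa [fanoutFn_apply, bitE] using this

/-! ### The amplified bit reads only the first `L₂` bits of its argument -/

/-- The `I`-th query input reads positions `< q² + ((N + mh) + N)` only. [folklore] -/
theorem inpT_congr {q N mh I : ℕ} {y y' : List Bool} (hq : N ≤ q)
    (h : ∀ i, i < q * q + ((N + mh) + N) → y.getD i false = y'.getD i false) :
    inpT q N mh I y = inpT q N mh I y' := by
  unfold inpT
  refine List.map_congr_left fun rr hrr => ?_
  rw [List.mem_range] at hrr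
  have hq0 : 0 < q := by omega
  have hpos : cikkPosT q mh I rr < q * q + ((N + mh) + N) := by
    unfold cikkPosT polyValT
    have h1 := Nat.mod_lt (((List.range mh).map fun c => if I.testBit c then rr ^ c else 0).sum) hq0
    have h2 : q * rr ≤ q * (q - 1) := Nat.mul_le_mul_left _ (by omega)
    have h3 : q + q * (q - 1) = q * q := by
      cases q with
      | zero => rfl
      | succ q => rw [Nat.add_sub_cancel, Nat.mul_add_one]; omega
    omega
  congr 1
  · exact h _ hpos
  · congr 1
    · congr 1
      refine List.map_congr_left fun c hc => ?_
      rw [List.mem_range] at hc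
      rw [h _ (by omega)]
    · exact h _ (by omega)

/-- **The amplified bit depends only on the first `L₂(m, n)` bits** of `y`. [folklore] -/
theorem ampT_congr {N' m n : ℕ} {r y y' : List Bool}
    (h : ∀ i, i < L2 m n → y.getD i false = y'.getD i false) : ampT N' m n r y = ampT N' m n r y' := by
  unfold ampT
  congr 1
  refine List.map_congr_left fun I _ => ?_
  rw [inpT_congr (q1_spec m).1 (fun i hi => h i (by unfold L2; exact hi))]

/-! ### On an honest pad the program computes the hard bit -/

/-- The fixed-width numerals are the rows of the truth-table enumeration. [folklore] -/
theorem getElem_natBits : ∀ (D v : ℕ) {i : ℕ} (hi : i < (natBits D v).length), (natBits D v)[i] = v.testBit i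
  | 0, v, i, hi => by simp at hi
  | D + 1, v, 0, _ => by simp [natBits, Nat.testBit_zero]
  | D + 1, v, i + 1, hi => by
    have hi' : i < (natBits D (v / 2)).length := by simpa [natBits] using hi
    simp only [natBits, List.getElem_cons_succ]
    rw [getElem_natBits D (v / 2) hi', Nat.testBit_add_one]

/-- The inverse enumeration reads the binary digits (cf. `EasyWitnessSearch.boolFunEquivFin_symm_apply`).
[folklore] -/
theorem boolFunEquivFin_symm_apply' {m : ℕ} (i : Fin (2 ^ m)) (j : Fin m) :
    (boolFunEquivFin m).symm i j = (i : ℕ).testBit j := by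
  have hx : ((finFunctionFinEquiv.symm i) j : ℕ) = i / 2 ^ (j : ℕ) % 2 :=
    finFunctionFinEquiv_symm_apply_val i j
  simp only [boolFunEquivFin, Equiv.arrowCongr, finTwoEquiv, Nat.testBit_eq_decide_div_mod_eq,
    Equiv.symm_trans_apply, Equiv.coe_fn_symm_mk, Equiv.refl_symm, Equiv.coe_refl, Function.comp_apply, id,
    Equiv.symm_symm, Equiv.coe_fn_mk]
  rw [← hx]
  generalize finFunctionFinEquiv.symm i j = x
  fin_cases x <;> rfl

/-- `ofFn` of the `i`-th assignment is the `m`-bit numeral of `i`. [folklore] -/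
theorem ofFn_boolFunEquivFin_symm {m : ℕ} (i : Fin (2 ^ m)) :
    List.ofFn ((boolFunEquivFin m).symm i) = natBits m i := by
  apply List.ext_getElem (by simp)
  intro k h₁ h₂
  rw [List.getElem_ofFn, boolFunEquivFin_symm_apply', getElem_natBits]

/-- `mOf n' ≤ n'`. [folklore] -/
theorem mOf_le (n' : ℕ) : mOf n' ≤ n' :=
  le_trans (by unfold mOf; omega) (Nat.unpair_right_le n')

/-- `jOf n' ≤ n'`. [folklore] -/
theorem jOf_le (n' : ℕ) : jOf n' ≤ n' := Nat.unpair_left_le n'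

variable (F)

/-- **On an honest pad `Φ` is the hard bit**: if the pad covers the table (`2^m ≤ P`), the target
(`(m+2)^j ≤ P`) and the budget of the decider on `m`-bit inputs (`F ⟨1^P, u⟩ = [u ∈ L]`), then
`Φ F (P, x) = hardBitAt L |x| x`. [cite: ImpagliazzoKabanetsWigderson2002, Thm. 11] -/
theorem Φ_eq_hardBitAt {L : Language Bool} {P : ℕ} {x : List Bool} (hPm : 2 ^ mOf x.length ≤ P)
    (hPn : tgtOf x.length ≤ P)
    (hF : ∀ u : List Bool, u.length = mOf x.length → F (boolPair (ones P) u) = [L.boolIndicator u]) :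
    Φ F (P, x) = hardBitAt L x.length x := by
  -- the decoded parameters
  have hlen : lenA (P, x) = x.length := rfl
  have hmA : mA (P, x) = mOf x.length := rfl
  have hjA : jA (P, x) = jOf x.length := rfl
  have hm : mU (P, x) = mOf x.length := by rw [mU, hmA, hlen, min_eq_left (mOf_le _)]
  have hj : jU (P, x) = jOf x.length := by rw [jU, hjA, hlen, min_eq_left (jOf_le _)]
  have hn : nA (P, x) = tgtOf x.length := by rw [nA, hmA, hj]; rfl
  have hnU : nU (P, x) = tgtOf x.length := by rw [nU, hn]; exact min_eq_left hPn
  -- the table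
  have hidx : tblIdx (P, x) = List.range (2 ^ mOf x.length) := by rw [tblIdx, hm]; exact congrArg _ (min_eq_left hPm)
  have htbl : tbl F (P, x) = truthTable (L.sliceFn (mOf x.length)) := by
    rw [tbl, hidx, truthTable]
    refine map_range_eq_ofFn _ _ fun i => ?_
    have hnb : List.takeD (mU (P, x)) (natE i) false = natBits (mOf x.length) i := by
      rw [hm]; exact PRGDerand.takeD_encodeNat_eq_natBits i.isLt
    rw [entry, hnb, hF _ (length_natBits _ _), List.headD_cons, Language.sliceFn, ofFn_boolFunEquivFin_symm]
  -- the amplified bit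
  unfold Φ cOf
  rw [hnU, htbl, mOfT_truthTable]
  unfold hardBitAt
  rw [← ampT_ofFn (L.sliceFn (mOf x.length)) (tgtOf x.length) (two_pow_N1_le_BT _ _ _)]
  refine ampT_congr fun i hi => ?_
  have hi' : i < (List.ofFn fun k : Fin (L2 (mOf x.length) (tgtOf x.length)) => x.getD k false).length := by
    rwa [List.length_ofFn]
  rw [List.getD_eq_getElem _ _ hi', List.getElem_ofFn]

/-! ### The language decided by the machine -/

/-- **The language decided**: the bit `Φ` on the pad `2^{|x|^{c₁}}`. [folklore] -/
def machLang (c₁ : ℕ) : Language Bool := {x | Φ F (2 ^ x.length ^ c₁, x) = true}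

/-- The indicator of `machLang` is `Φ` on the pad. [folklore] -/
theorem boolIndicator_machLang (c₁ : ℕ) (x : List Bool) :
    (machLang F c₁).boolIndicator x = Φ F (2 ^ x.length ^ c₁, x) := by
  by_cases h : Φ F (2 ^ x.length ^ c₁, x) = true
  · rw [(Set.mem_iff_boolIndicator _ _).1 (show x ∈ machLang F c₁ from h), h]
  · rw [Bool.not_eq_true] at h
    have hn : x ∉ machLang F c₁ := fun hw => by
      have hw' : Φ F (2 ^ x.length ^ c₁, x) = true := hw
      rw [h] at hw'; exact Bool.false_ne_true hw'
    rw [(Set.notMem_iff_boolIndicator _ _).1 hn, h]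

variable {F}

/-- One constant for the running time of "pad, then a polynomial-time pass". [folklore] -/
theorem exists_time_const (p : Polynomial ℕ) (C c₁ : ℕ) (hc₁ : 1 ≤ c₁) :
    ∃ c' : ℕ, ∀ n : ℕ, p.eval (2 * 2 ^ (n ^ c₁)) + (C * 2 ^ (n ^ c₁) + C) ≤ c' * 2 ^ (n ^ (c₁ + 1)) + c' := by
  obtain ⟨cp, kp, hcp⟩ := exists_eval_le_mul_pow_add p
  refine exists_const_of_eventually_le ?_
  -- with `a = n^{c₁}`: everything is `≤ K · 2^{(kp+1) a} ≤ 2^{(kp+2) a} ≤ 2^{n^{c₁+1}}` for large `n`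
  set K : ℕ := cp * 2 ^ kp + cp + 2 * C with hK
  filter_upwards [eventually_ge_atTop (K + kp + 2)] with n hn
  have hn1 : 1 ≤ n := by omega
  have ha : n ≤ n ^ c₁ := Nat.le_self_pow (by omega) n
  have h2a : 1 ≤ 2 ^ (n ^ c₁) := Nat.one_le_two_pow
  have hpow : (2 * 2 ^ (n ^ c₁)) ^ kp = 2 ^ kp * 2 ^ (kp * n ^ c₁) := by rw [mul_pow, ← pow_mul, Nat.mul_comm (n ^ c₁) kp]
  have h1 : p.eval (2 * 2 ^ (n ^ c₁)) + (C * 2 ^ (n ^ c₁) + C) ≤ K * 2 ^ ((kp + 1) * n ^ c₁) := by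
    have e1 : 2 ^ (kp * n ^ c₁) ≤ 2 ^ ((kp + 1) * n ^ c₁) :=
      Nat.pow_le_pow_right (by norm_num) (Nat.mul_le_mul_right _ (by omega))
    have e2 : 2 ^ (n ^ c₁) ≤ 2 ^ ((kp + 1) * n ^ c₁) :=
      Nat.pow_le_pow_right (by norm_num) (by nlinarith)
    have e3 : 1 ≤ 2 ^ ((kp + 1) * n ^ c₁) := Nat.one_le_two_pow
    calc p.eval (2 * 2 ^ (n ^ c₁)) + (C * 2 ^ (n ^ c₁) + C)
        ≤ cp * (2 * 2 ^ (n ^ c₁)) ^ kp + cp + (C * 2 ^ (n ^ c₁) + C) := Nat.add_le_add_right (hcp _) _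
      _ = cp * 2 ^ kp * 2 ^ (kp * n ^ c₁) + cp + (C * 2 ^ (n ^ c₁) + C) := by rw [hpow, mul_assoc]
      _ ≤ cp * 2 ^ kp * 2 ^ ((kp + 1) * n ^ c₁) + cp * 2 ^ ((kp + 1) * n ^ c₁) +
            (C * 2 ^ ((kp + 1) * n ^ c₁) + C * 2 ^ ((kp + 1) * n ^ c₁)) := by
          gcongr
          · exact Nat.le_mul_of_pos_right _ e3
          · exact Nat.le_mul_of_pos_right _ e3
      _ = K * 2 ^ ((kp + 1) * n ^ c₁) := by rw [hK]; ring
  have hK2 : K ≤ 2 ^ (n ^ c₁) := by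
    calc K ≤ n := by omega
      _ ≤ 2 ^ n := Nat.lt_two_pow_self.le
      _ ≤ 2 ^ (n ^ c₁) := Nat.pow_le_pow_right (by norm_num) ha
  have h2 : K * 2 ^ ((kp + 1) * n ^ c₁) ≤ 2 ^ (n ^ (c₁ + 1)) := by
    calc K * 2 ^ ((kp + 1) * n ^ c₁) ≤ 2 ^ (n ^ c₁) * 2 ^ ((kp + 1) * n ^ c₁) := Nat.mul_le_mul_right _ hK2
      _ = 2 ^ ((kp + 2) * n ^ c₁) := by rw [← pow_add]; ring_nf
      _ ≤ 2 ^ (n ^ (c₁ + 1)) := by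
          refine Nat.pow_le_pow_right (by norm_num) ?_
          rw [pow_succ]
          nlinarith
  exact h1.trans h2

/-- **The machine's language is in `DTIME(2^{n^{c₁+1}})`**: pad (`expPad c₁`, time `C 2^{n^{c₁}} + C`),
then the `FP` pass `exists_FP_Φ` on the padded string (of length `≤ 2 · 2^{n^{c₁}}`).
[cite: AroraBarakCC2009, §2.6.2 and §1.3] -/
theorem machLang_mem_DTIME (hF : F ∈ FP) {c₁ : ℕ} (hc₁ : 1 ≤ c₁) :
    machLang F c₁ ∈ DTIME (fun n => 2 ^ n ^ (c₁ + 1)) := by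
  obtain ⟨Q, hQ, hQΦ⟩ := exists_FP_Φ hF
  obtain ⟨C, ME, hME⟩ := exists_timeComputable_expPad hc₁
  obtain ⟨pQ, MQ, hMQ⟩ := hQ
  obtain ⟨c', hc'⟩ := exists_time_const pQ C c₁ hc₁
  refine ⟨c', ME.comp MQ, fun x => ?_⟩
  have h1 : ME.OutputsWithin x (expPad c₁ x) (C * 2 ^ (x.length ^ c₁) + C) := by simpa using hME x
  have h2 : MQ.OutputsWithin (expPad c₁ x) (encodeBool ((machLang F c₁).boolIndicator x)) (pQ.eval (expPad c₁ x).length) := by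
    have := hMQ (expPad c₁ x)
    rw [id, show Q (expPad c₁ x) = encodeBool ((machLang F c₁).boolIndicator x) by
      rw [boolIndicator_machLang]; exact hQΦ _ _] at this
    exact this
  refine (Turing.TM2ComputableAux.comp_outputsWithin ME MQ h1 h2).mono ?_
  refine le_trans (Nat.add_le_add_right (natPoly_eval_mono pQ (length_expPad_le hc₁ x)) _) ?_
  simpa using hc' x.length

/-- **For all large lengths the machine's slices are the slices of `hardLang L`** (`c₁ > b`, `c₁ ≥ 3`,
`F` the budgeted decider of `L ∈ DTIME(2^{n^b})`). [cite: AroraBarakCC2009, §2.6.2] -/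
theorem eventually_sliceFn_machLang_eq {L : Language Bool} {b c₁ c : ℕ} {p : Polynomial ℕ}
    (hF : ∀ u x : List Bool, p.eval (c * 2 ^ x.length ^ b + c) ≤ u.length → F (boolPair u x) = [L.boolIndicator x])
    (hc₁ : b < c₁) (h3 : 3 ≤ c₁) :
    ∀ᶠ n' in atTop, (machLang F c₁).sliceFn n' = (hardLang L).sliceFn n' := by
  filter_upwards [eventually_eval_mul_two_pow_pow_le p (2 * c) b, eventually_ge_atTop 2] with n' hbud hn'
  have hP : ∀ m', m' ≤ n' → p.eval (c * 2 ^ m' ^ b + c) ≤ 2 ^ n' ^ c₁ := by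
    intro m' hm'
    have h1 : c * 2 ^ m' ^ b + c ≤ 2 * c * 2 ^ n' ^ b := by
      have e1 : 2 ^ m' ^ b ≤ 2 ^ n' ^ b := Nat.pow_le_pow_right (by norm_num) (Nat.pow_le_pow_left hm' b)
      have e2 : c ≤ c * 2 ^ n' ^ b := Nat.le_mul_of_pos_right c Nat.one_le_two_pow
      nlinarith
    have h2 : 2 ^ n' ^ (b + 1) ≤ 2 ^ n' ^ c₁ := Nat.pow_le_pow_right (by norm_num) (Nat.pow_le_pow_right (by omega) hc₁)
    exact ((natPoly_eval_mono p h1).trans hbud).trans h2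
  funext u
  rw [sliceFn_hardLang_apply]
  have hx : (List.ofFn u).length = n' := List.length_ofFn
  -- the machine's slice is `Φ` on the pad
  have hmach : (machLang F c₁).sliceFn n' u = Φ F (2 ^ n' ^ c₁, List.ofFn u) := by
    show (machLang F c₁).boolIndicator (List.ofFn u) = _
    rw [boolIndicator_machLang, hx]
  rw [hmach]
  have key := Φ_eq_hardBitAt F (L := L) (P := 2 ^ n' ^ c₁) (x := List.ofFn u) ?_ ?_ ?_
  · rwa [hx] at key
  · -- table: `2^m ≤ 2^{n'^{c₁}}`
    rw [hx]
    exact Nat.pow_le_pow_right (by norm_num) ((mOf_le n').trans (Nat.le_self_pow (by omega) n'))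
  · -- target: `(m+2)^j ≤ (n'+2)^{n'} ≤ (2^{n'+1})^{n'} ≤ 2^{n'^3} ≤ 2^{n'^{c₁}}`
    rw [hx, tgtOf]
    have h1 : (mOf n' + 2) ^ jOf n' ≤ (n' + 2) ^ n' := by
      calc (mOf n' + 2) ^ jOf n' ≤ (n' + 2) ^ jOf n' := Nat.pow_le_pow_left (by have := mOf_le n'; omega) _
        _ ≤ (n' + 2) ^ n' := Nat.pow_le_pow_right (by omega) (jOf_le n')
    have h2 : n' + 2 ≤ 2 ^ n' := by
      obtain ⟨k, rfl⟩ : ∃ k, n' = k + 2 := ⟨n' - 2, by omega⟩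
      have hk : k + 1 < 2 ^ (k + 1) := Nat.lt_two_pow_self
      rw [pow_succ]; omega
    have h3 : (n' + 2) ^ n' ≤ 2 ^ (n' ^ c₁) := by
      calc (n' + 2) ^ n' ≤ (2 ^ n') ^ n' := Nat.pow_le_pow_left h2 _
        _ = 2 ^ (n' ^ 2) := by rw [← pow_mul, sq]
        _ ≤ 2 ^ (n' ^ c₁) := Nat.pow_le_pow_right (by norm_num) (Nat.pow_le_pow_right (by omega) (by omega))
    exact h1.trans h3
  · -- budget on `m`-bit inputs
    intro v hv
    refine hF (ones (2 ^ n' ^ c₁)) v ?_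
    rw [hv, hx]
    simpa [ones] using hP (mOf n') (mOf_le n')

/-- **Under `EXP ⊄ P/poly` some language in `DTIME(2^{n^{b'}})` is infinitely often average-case hard for
every polynomial size** — Babai–Fortnow–Nisan–Wigderson's theorem in the form consumed by the case
`EXP ⊄ P/poly` of Impagliazzo–Wigderson 1998 (`Learning/IWPadGeneratorFools.uniformPRG_of_ioAvgHard`).
[cite: ImpagliazzoWigderson2001, §2.1] [cite: VanMelkebeek2000, Thm. 2.3.7] [cite: ImpagliazzoKabanetsWigderson2002, Thm. 11] -/
theorem exists_ioAvgHard_of_not_EXP_subset_PPoly (h : ¬ EXP ⊆ PPoly) :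
    ∃ (H : Language Bool) (b' : ℕ), H ∈ DTIME (fun n => 2 ^ n ^ b') ∧
      ∀ c : ℕ, ∃ᶠ n in atTop, AvgHardAtLeast (H.sliceFn n) ((n : ℝ) ^ c) := by
  obtain ⟨L, b, hL, hhard⟩ := exists_hard_of_not_EXP_subset_PPoly h
  obtain ⟨F, hF, c, p, hFv⟩ := exists_FP_decide_of_budget hL
  refine ⟨machLang F (b + 3), b + 3 + 1, machLang_mem_DTIME hF (by omega), fun c' => ?_⟩
  refine (frequently_avgHardAtLeast_hardLang L hhard c').mp ?_
  filter_upwards [eventually_sliceFn_machLang_eq (F := F) (L := L) (c₁ := b + 3) hFv (by omega) (by omega)]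
    with n' he hh
  rwa [he]

end IoHard

end Literature.Computability.Complexity

end
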